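import Mathlib
import HarnessLib
import Literature.Geometry.DiscreteGeometry.KissingPatterns

/-!
# Line `birth` of crux `FreeSplittingCertificates.ShellRigidityHcp` (stmt-AtomisticToContinuum-12561): stub `stub_emptyZone`

The "empty zone" lemma of the compactness upgrade.  In a finite configuration
`x : Fin N → ℝ³` write `T_k` for the recentred first shell of the site `k` (the vectors
`x l - x k`, `l ≠ k`, of length `≤ 5a/4`) and
`S(a,t) := hcpKissingPattern.image (u ↦ a • (u + (t (u₀+u₁+u₂)/3) • (1,1,1)))` for the stretched
anticuboctahedral shell.  If the shells of two sites `j ≠ k` are both `η`-close (`η ≤ a/100`) to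
`S(a,t)` after linear isometries and `dist (x j) (x k) ≤ 4a/3`, then `dist (x j) (x k) ≤ 5a/4`:
the zone `(5a/4, 4a/3]` about a constrained site contains no constrained site.

Proof.  Suppose `5a/4 < d := ‖v‖ ≤ 4a/3`, `v := x j - x k`.  By the `45°` covering property of the
rotated pattern (first hypothesis) some `u ∈ hcpKissingPattern` has `‖v‖ ≤ √2 ⟪v, A u⟫`, whence
`‖v - a • A u‖² = d² - 2a ⟪v, A u⟫ + a² ≤ d² - √2 a d + a² ≤ a² (25/9 - 4√2/3) < (0.9446 a)²`.
By the norm facts (second hypothesis) the shell point `A p` of `k` (`p` the stretched `a • u`) is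
within `a/100` of `a • A u`, and the particle `x l` of `k`'s shell matched to it is within `η` of
`x k + A p`; hence `dist (x l) (x j) ≤ 0.9646 a`, and `l ≠ j` because
`‖v‖ > 5a/4 > 1.02 a ≥ ‖A p‖ + η`.  So `x l - x j` lies in `j`'s shell, all of whose points have
norm `≥ 0.99 a - η ≥ 0.98 a` — a contradiction.

Sources: elementary metric geometry (folklore); the two facts about the hcp pattern that are used
(covering radius `45°`, norms of the stretched shell) enter as hypotheses, supplied by the
neighbouring stubs of the line.
-/

noncomputable section

namespace Summit.AtomisticToContinuum.Crystallization.Theorems.ShellRigidityHcpBirth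

open Literature.Geometry.DiscreteGeometry

/-- Decimal bounds `1.41421 < √2 < 1.41422`. [folklore] -/
private theorem sqrt_two_bounds :
    (141421 / 100000 : ℝ) < Real.sqrt 2 ∧ Real.sqrt 2 < 141422 / 100000 := by
  constructor
  · rw [Real.lt_sqrt (by norm_num)]
    norm_num
  · rw [Real.sqrt_lt' (by norm_num)]
    norm_num

/-- The key inequality: if the unit vector `w` makes an angle `≤ 45°` with `v`
(`‖v‖ ≤ √2 ⟪v, w⟫`) and `5a/4 < ‖v‖ ≤ 4a/3`, then `‖v - a • w‖ ≤ 0.9446 a`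
(`‖v - a • w‖² ≤ ‖v‖² - √2 a ‖v‖ + a² ≤ a² (25/9 - 4√2/3) < (0.9446 a)²`). [folklore] -/
private theorem norm_sub_smul_le_of_covering {v w : EuclideanSpace ℝ (Fin 3)} {a : ℝ}
    (ha : 0 < a) (hw : ‖w‖ = 1) (hcov : ‖v‖ ≤ Real.sqrt 2 * inner ℝ v w)
    (hd1 : 5 * a / 4 < ‖v‖) (hd2 : ‖v‖ ≤ 4 * a / 3) :
    ‖v - a • w‖ ≤ 9446 / 10000 * a := by
  obtain ⟨hs1, hs2⟩ := sqrt_two_bounds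
  have hss : Real.sqrt 2 * Real.sqrt 2 = 2 := Real.mul_self_sqrt (by norm_num)
  have hi : Real.sqrt 2 * ‖v‖ ≤ 2 * inner ℝ v w := by
    calc Real.sqrt 2 * ‖v‖ ≤ Real.sqrt 2 * (Real.sqrt 2 * inner ℝ v w) :=
          mul_le_mul_of_nonneg_left hcov (Real.sqrt_nonneg 2)
      _ = 2 * inner ℝ v w := by rw [← mul_assoc, hss]
  have hsq : ‖v - a • w‖ ^ 2 ≤ (9446 / 10000 * a) ^ 2 := by
    rw [norm_sub_sq_real, real_inner_smul_right, norm_smul, Real.norm_eq_abs, abs_of_pos ha, hw,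
      mul_one]
    have h1 : a * (Real.sqrt 2 * ‖v‖) ≤ a * (2 * inner ℝ v w) :=
      mul_le_mul_of_nonneg_left hi ha.le
    have h2 : Real.sqrt 2 * a < 141422 / 100000 * a := mul_lt_mul_of_pos_right hs2 ha
    have h3 : 0 ≤ (4 * a / 3 - ‖v‖) * (‖v‖ + 4 * a / 3 - Real.sqrt 2 * a) :=
      mul_nonneg (sub_nonneg.2 hd2) (by linarith)
    have h4 : 141421 / 100000 * (a * a) < Real.sqrt 2 * (a * a) :=
      mul_lt_mul_of_pos_right hs1 (mul_pos ha ha)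
    nlinarith [h1, h3, h4]
  exact (pow_le_pow_iff_left₀ (norm_nonneg _) (by positivity) two_ne_zero).1 hsq

/-- The empty-zone argument for an abstract shell map `f` on the pattern: only the covering
property of the (rotated) pattern and the norm facts `0.99 a < ‖f u‖ < 1.01 a`,
`‖f u - a • u‖ ≤ a/100` of the shell points are used. [folklore] -/
private theorem emptyZone_aux
    (hcov : ∀ (A : EuclideanSpace ℝ (Fin 3) →ₗᵢ[ℝ] EuclideanSpace ℝ (Fin 3))
      (x : EuclideanSpace ℝ (Fin 3)), ∃ u ∈ hcpKissingPattern, ‖x‖ ≤ Real.sqrt 2 * inner ℝ x (A u))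
    {a η : ℝ} (ha : 0 < a) (hη : η ≤ a / 100)
    {f : EuclideanSpace ℝ (Fin 3) → EuclideanSpace ℝ (Fin 3)} {N : ℕ}
    (x : Fin N → EuclideanSpace ℝ (Fin 3)) (k j : Fin N)
    (hk : ShellCloseTo η
      ((Finset.univ.filter fun l => l ≠ k ∧ dist (x l) (x k) ≤ 5 * a / 4).image fun l => x l - x k)
      (hcpKissingPattern.image f))
    (hj : ShellCloseTo η
      ((Finset.univ.filter fun l => l ≠ j ∧ dist (x l) (x j) ≤ 5 * a / 4).image fun l => x l - x j)
      (hcpKissingPattern.image f))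
    (hd : dist (x j) (x k) ≤ 4 * a / 3)
    (hf : ∀ u ∈ hcpKissingPattern,
      99 / 100 * a < ‖f u‖ ∧ ‖f u‖ < 101 / 100 * a ∧ ‖f u - a • u‖ ≤ a / 100) :
    dist (x j) (x k) ≤ 5 * a / 4 := by
  by_contra hcon
  rw [not_le] at hcon
  rw [dist_eq_norm] at hcon hd
  -- Step 1: unfold the closeness of `k`'s shell and pick the covering direction `A u` of `v`.
  obtain ⟨A, e, he⟩ := hk
  obtain ⟨u, hu, hcovu⟩ := hcov A (x j - x k)
  obtain ⟨-, hn2, hn3⟩ := hf u hu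
  have hAu : ‖A u‖ = 1 := by
    rw [LinearIsometry.norm_map]
    exact norm_eq_one_of_mem_hcpKissingPattern hu
  -- Step 2: the key inequality `‖v - a • A u‖ ≤ 0.9446 a`, hence `dist v (A (f u)) ≤ 0.9546 a`.
  have hkey : ‖(x j - x k) - a • A u‖ ≤ 9446 / 10000 * a :=
    norm_sub_smul_le_of_covering ha hAu hcovu hcon hd
  have hcu : ‖a • A u - A (f u)‖ ≤ a / 100 := by
    rw [← LinearIsometry.map_smul, ← map_sub A, LinearIsometry.norm_map, norm_sub_rev]
    exact hn3
  have hvc : dist (A (f u)) (x j - x k) ≤ 9446 / 10000 * a + a / 100 := by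
    rw [dist_comm]
    refine (dist_triangle (x j - x k) (a • A u) (A (f u))).trans (add_le_add ?_ ?_)
    · rw [dist_eq_norm]
      exact hkey
    · rw [dist_eq_norm]
      exact hcu
  -- Step 3: the particle `x l` of `k`'s shell matched to the shell point `A (f u)`.
  have hc : A (f u) ∈ (hcpKissingPattern.image f).image A :=
    Finset.mem_image_of_mem A (Finset.mem_image_of_mem f hu)
  obtain ⟨l, -, hlk⟩ := Finset.mem_image.1 (e.symm ⟨A (f u), hc⟩).2
  have hlc : dist (x l - x k) (A (f u)) ≤ η := by
    have h := he (e.symm ⟨A (f u), hc⟩)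
    rw [Equiv.apply_symm_apply, ← hlk] at h
    exact h
  have hdlj : dist (x l) (x j) ≤ η + (9446 / 10000 * a + a / 100) := by
    have h3 : dist (x l - x k) (x j - x k) = dist (x l) (x j) := by
      rw [dist_eq_norm, dist_eq_norm, sub_sub_sub_cancel_right]
    rw [← h3]
    exact (dist_triangle _ (A (f u)) _).trans (add_le_add hlc hvc)
  -- Step 4: `l ≠ j`, since `‖v‖ > 5a/4 > ‖A (f u)‖ + η`.
  have hlj : l ≠ j := by
    intro hlj
    rw [hlj] at hlc
    have h1 := norm_sub_norm_le (x j - x k) (A (f u))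
    rw [← dist_eq_norm (x j - x k) (A (f u)), LinearIsometry.norm_map] at h1
    linarith
  -- Step 5: so `x l - x j` is a point of `j`'s shell, of norm `≤ 0.9646 a` ...
  have hmem : x l - x j ∈
      (Finset.univ.filter fun l => l ≠ j ∧ dist (x l) (x j) ≤ 5 * a / 4).image fun l => x l - x j :=
    Finset.mem_image_of_mem (fun l => x l - x j)
      (Finset.mem_filter.2 ⟨Finset.mem_univ _, hlj, by linarith⟩)
  -- ... whereas every point of a constrained shell has norm `≥ 0.99 a - η`.
  obtain ⟨A', e', he'⟩ := hj
  obtain ⟨p', hp', hp'eq⟩ := Finset.mem_image.1 (e' ⟨x l - x j, hmem⟩).2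
  obtain ⟨u', hu', rfl⟩ := Finset.mem_image.1 hp'
  obtain ⟨hn1', -, -⟩ := hf u' hu'
  have h1 : dist (x l - x j) (A' (f u')) ≤ η := by
    have h := he' ⟨x l - x j, hmem⟩
    rw [← hp'eq] at h
    exact h
  have h2 := norm_sub_norm_le (A' (f u')) (x l - x j)
  rw [← dist_eq_norm (A' (f u')) (x l - x j), dist_comm (A' (f u')) (x l - x j),
    LinearIsometry.norm_map] at h2
  rw [dist_eq_norm] at hdlj
  linarith

/-- **stub_emptyZone** (no constrained site in the zone `(5a/4, 4a/3]` about a constrained site):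
from the covering property of the rotated hcp pattern and the norm facts of the stretched shell —
in a finite configuration, if the first shells (radius `5a/4`) of `k` and of `j ≠ k` are both
`η`-close to `S(a,t)` with `η ≤ a/100` and `dist (x j) (x k) ≤ 4a/3`, then
`dist (x j) (x k) ≤ 5a/4`. [folklore] -/
theorem stub_emptyZone :
    (∀ (A : EuclideanSpace ℝ (Fin 3) →ₗᵢ[ℝ] EuclideanSpace ℝ (Fin 3)) (x : EuclideanSpace ℝ (Fin 3)),
      ∃ u ∈ hcpKissingPattern, ‖x‖ ≤ Real.sqrt 2 * inner ℝ x (A u)) →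
    (∀ a t : ℝ, 0 < a → |t| ≤ 1 / 100 →
      ∀ u ∈ hcpKissingPattern,
        99 / 100 * a < ‖a • (u + (t * (u 0 + u 1 + u 2) / 3) • intVec ![1, 1, 1])‖ ∧
        ‖a • (u + (t * (u 0 + u 1 + u 2) / 3) • intVec ![1, 1, 1])‖ < 101 / 100 * a ∧
        ‖a • (u + (t * (u 0 + u 1 + u 2) / 3) • intVec ![1, 1, 1]) - a • u‖ ≤ a / 100) →
    ∀ a t η : ℝ, 0 < a → |t| ≤ 1 / 100 → η ≤ a / 100 →
      ∀ (N : ℕ) (x : Fin N → EuclideanSpace ℝ (Fin 3)) (k j : Fin N),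
        ShellCloseTo η
          ((Finset.univ.filter fun l => l ≠ k ∧ dist (x l) (x k) ≤ 5 * a / 4).image fun l => x l - x k)
          (hcpKissingPattern.image fun u => a • (u + (t * (u 0 + u 1 + u 2) / 3) • intVec ![1, 1, 1])) →
        ShellCloseTo η
          ((Finset.univ.filter fun l => l ≠ j ∧ dist (x l) (x j) ≤ 5 * a / 4).image fun l => x l - x j)
          (hcpKissingPattern.image fun u => a • (u + (t * (u 0 + u 1 + u 2) / 3) • intVec ![1, 1, 1])) →
        j ≠ k → dist (x j) (x k) ≤ 4 * a / 3 → dist (x j) (x k) ≤ 5 * a / 4 := by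
  intro hcov hnorm a t η ha ht hη N x k j hk hj _ hd
  exact emptyZone_aux hcov ha hη x k j hk hj hd fun u hu => hnorm a t ha ht u hu

end Summit.AtomisticToContinuum.Crystallization.Theorems.ShellRigidityHcpBirth

end
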